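import Literature.MathematicalPhysics.QuantumFieldTheory.Balaban1983to89.Beta.Drift

/-!
# Beta/MarginalTelescoping — composed marginal coefficient vs flow partial sums (bookkeeping for [H-germ]; β sub-cell)

HONEST FRAMING (cell `pub-balaban`, BETA-SPEC §8, HOME/BETA/AN1.md §7, AN2.md §6): the β sub-cell reduces the one-loop
input of [Balaban1987RG1] Theorem 2 to the DRIFT form `Beta.Drift.OneLoopDrift b A β⁰` of the partial sums
`Σ_{j<k} β⁰_{j+1}`, and wants to read those partial sums as the marginal coefficient `c_k` of the COMPOSED one-loop
functional after `k` steps.  The identification `c_k = Σ_{j<k} β⁰_{j+1}` ("[H-germ]") is the subject of this module —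
as pure real bookkeeping.  NOTHING about Bałaban's actual coefficients is asserted: every `def … : Prop` is a HYPOTHESIS
SHAPE, every theorem is elementary, and the two witnesses are abstract sequences.  Value = kernel bookkeeping, NOT
summit progress (the summit is the Clay problem; even the cell's target, ultraviolet stability made unconditional, is not).

Printed context (read on page images, cell file HOME/b2b-balaban-pv28/HGERM-READING.md).  [Balaban1987RG1]
(CMP 109 (1987) 249–301) defines the β-function of one step from the scale's OWN polarization tensor: p. 264, (1.20)
«Π^{ab}_{j+1,μν}(g_j, x, x′) = (δ²/(δB^a_μ(x)δB^b_ν(x′)) E^{(j+1)})(g_j, 0)», «This is the vacuum polarization tensor of the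
theory defined by the j-th fluctuation field integral», and (1.22) «β_{j+1}(g_j) = … = Σ_x Π_{j+1,μν}(g_j, x)x_μx_ν (1.22)
for μ, ν arbitrary, μ ≠ ν»; equivalently p. 292, (5.1) «Π(b, b′) = lim_{T₁^{(j)}↗Z⁴} δ²/(δB(b)δB(b′)) E^{(j)}(U_j(exp iB))|_{B=0}»
with p. 297, (5.42) «β = −(∂²Π₁₂/∂p₁∂p₂)(0) = −(∂²Π_{μν}/∂p_μ∂p_ν)(0) = Σ_x Π_{μν}(x)x_μx_ν (5.42) for μ ≠ ν. This is the
fundamental equality defining the β-function.» and p. 298 «In fact we should write the superscript (j) at the tensor in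
the formula (5.42) defining the function β_j.»  At a later step `k` the old terms are re-expanded through the scale-j
minimiser by the composition (3.3), p. 270, and the marginal parts of the old term and of its counterterm cancel
identically in the composite field, p. 292 l. 7–9: «We define the β-function β_j(g_{j−1}) equal to this coefficient.
The corresponding terms from (4.34) are equal to (4.42), (4.44) also, hence both groups of terms cancel, because (4.38)
appears with the minus sign in the effective action (1.6).»  What is NOT cancelled are controlled replacement terms
(finite torus vs the Z⁴ limit in (5.1); H_j(□₀) → H_j, (4.39)→(4.40); domain extensions (4.36); third-order terms of
(5.43)), each small in the scale separation `k − j` (factors of `L^jη = L^{−(k−j)}`).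

The bookkeeping.  Let `μ j m` be the marginal coefficient contributed by old term `j` inside the step-`m` composed
functional (`m ≥ j+1`) and `β0 j` (= β_{j+1}) the flow coefficient.  `composedCoeff μ k = Σ_{j<k} μ j k`,
`flowSum β0 k = Σ_{j<k} β0 j`, `defect = composedCoeff − flowSum = Σ_{j<k} (μ j k − β0 j)` (`defect_eq_sum`).
* (I)  identity shape `IdentityForm`: `μ j k = β0 j` for `j < k` ⇒ no defect.
* (II) PRINT'S SHAPE `SeparationRate C θ`: `|μ j k − β0 j| ≤ C θ^{k−j}` ⇒ `|defect| ≤ Cθ/(1−θ)` UNIFORMLY in `k`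
       (`abs_defect_le_of_separationRate`), hence a drift for the composed coefficient transfers to `OneLoopDrift` with
       the SAME slope `b` and `A ↦ A + Cθ/(1−θ)` (`oneLoopDrift_of_composedDrift`) and conversely.
* (III) the relative-rate shape typed in the cell as O-an2-5, `RelativeRate C θ`: `|μ j (m+1) − μ j m| ≤ C θ^{m−j}`,
       gives only `|μ j k − μ j (j+1)| ≤ Cθ/(1−θ)` per `j` and `|defect| ≤ k·Cθ/(1−θ)` — and this is sharp in shape:
       `slopeWitness` satisfies (III) with a defect growing like `(k−1)δ` (the slope changes), and `oscWitness` satisfies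
       (III) while its composed coefficient admits NO drift line at all (`oscWitness_no_drift`).  So (III) is too weak
       for the transfer; (II) (which implies (III), `relativeRate_of_separationRate`) is the shape to carry.
-/

namespace Literature.MathematicalPhysics.QuantumFieldTheory.Balaban1983to89.Beta.MarginalTelescoping

open Literature.MathematicalPhysics.QuantumFieldTheory.Balaban1983to89
open Finset

/-! ## The two sums and the defect -/

/-- The marginal coefficient of the composed functional after `k` steps, as a sum over the old terms `j < k` of their
contributions `μ j k` at step `k` (bookkeeping shape; linearity of the moment functional (1.22) in the kernel).
[cite: Balaban1987RG1, (1.22) p.264 and (3.3) p.270] -/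
def composedCoeff (μ : ℕ → ℕ → ℝ) (k : ℕ) : ℝ := ∑ j ∈ range k, μ j k

/-- The flow partial sum `Σ_{j<k} β0 j` (with `β0 j` standing for β_{j+1} of (1.22)); this is literally the sum in
`Beta.Drift.OneLoopDrift`. [cite: Balaban1987RG1, (1.22) p.264] -/
def flowSum (β0 : ℕ → ℝ) (k : ℕ) : ℝ := ∑ j ∈ range k, β0 j

/-- The defect `composedCoeff − flowSum` at step `k`. [folklore] -/
def defect (μ : ℕ → ℕ → ℝ) (β0 : ℕ → ℝ) (k : ℕ) : ℝ := composedCoeff μ k - flowSum β0 k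

/-- The defect is the sum of the termwise discrepancies `μ j k − β0 j`, `j < k` (exact). [folklore] -/
theorem defect_eq_sum (μ : ℕ → ℕ → ℝ) (β0 : ℕ → ℝ) (k : ℕ) :
    defect μ β0 k = ∑ j ∈ range k, (μ j k - β0 j) := by
  unfold defect composedCoeff flowSum
  rw [sum_sub_distrib]

/-! ## (I) identity shape -/

/-- HYPOTHESIS SHAPE (I): the contribution of old term `j` at every later step equals the flow coefficient
(the cell's first reading of [H-germ], AN1.md §7; a predicate, never a fact). [cite: Balaban1987RG1, p.292 l.2–9] -/
def IdentityForm (μ : ℕ → ℕ → ℝ) (β0 : ℕ → ℝ) : Prop :=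
  ∀ j k : ℕ, j < k → μ j k = β0 j

/-- Under (I) the composed coefficient IS the flow partial sum. [folklore] -/
theorem composedCoeff_eq_flowSum_of_identity {μ : ℕ → ℕ → ℝ} {β0 : ℕ → ℝ} (h : IdentityForm μ β0) (k : ℕ) :
    composedCoeff μ k = flowSum β0 k := by
  unfold composedCoeff flowSum
  refine sum_congr rfl fun j hj => ?_
  exact h j k (mem_range.mp hj)

/-! ## (II) print's shape: discrepancies decaying in the scale separation -/

/-- HYPOTHESIS SHAPE (II): `|μ j k − β0 j| ≤ C θ^{k−j}` for `j < k` — the discrepancy of old term `j` at step `k` is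
small in the scale separation `k − j` (the shape of the printed replacement estimates, factors of `L^{−(k−j)}`).
[cite: Balaban1987RG1, p.290 (4.35)–(4.36) and p.292 l.2–9] -/
def SeparationRate (C θ : ℝ) (μ : ℕ → ℕ → ℝ) (β0 : ℕ → ℝ) : Prop :=
  ∀ j k : ℕ, j < k → |μ j k - β0 j| ≤ C * θ ^ (k - j)

/-- The geometric tail `Σ_{j<k} θ^{k−j} ≤ θ/(1−θ)`, uniformly in `k`. [folklore] -/
theorem sum_pow_sub_le {θ : ℝ} (hθ0 : 0 ≤ θ) (hθ1 : θ < 1) (k : ℕ) :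
    ∑ j ∈ range k, θ ^ (k - j) ≤ θ / (1 - θ) := by
  have h1 : 0 < 1 - θ := sub_pos.mpr hθ1
  induction k with
  | zero => simpa using div_nonneg hθ0 h1.le
  | succ k ih =>
    rw [sum_range_succ, Nat.add_sub_cancel_left, pow_one]
    have hre : ∑ j ∈ range k, θ ^ (k + 1 - j) = θ * ∑ j ∈ range k, θ ^ (k - j) := by
      rw [mul_sum]
      refine sum_congr rfl fun j hj => ?_
      have hjk := mem_range.mp hj
      rw [show k + 1 - j = (k - j) + 1 by omega, pow_succ]
      ring
    rw [hre]
    calc θ * ∑ j ∈ range k, θ ^ (k - j) + θ ≤ θ * (θ / (1 - θ)) + θ := by gcongr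
      _ = θ / (1 - θ) := by field_simp; ring

/-- **(II) ⇒ k-uniform defect.**  Under `SeparationRate C θ` with `0 ≤ C`, `0 ≤ θ < 1`:
`|composedCoeff μ k − flowSum β0 k| ≤ Cθ/(1−θ)` for every `k`. [folklore] -/
theorem abs_defect_le_of_separationRate {C θ : ℝ} {μ : ℕ → ℕ → ℝ} {β0 : ℕ → ℝ} (hC : 0 ≤ C) (hθ0 : 0 ≤ θ)
    (hθ1 : θ < 1) (h : SeparationRate C θ μ β0) (k : ℕ) : |defect μ β0 k| ≤ C * θ / (1 - θ) := by
  rw [defect_eq_sum]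
  calc |∑ j ∈ range k, (μ j k - β0 j)| ≤ ∑ j ∈ range k, |μ j k - β0 j| := abs_sum_le_sum_abs _ _
    _ ≤ ∑ j ∈ range k, C * θ ^ (k - j) := sum_le_sum fun j hj => h j k (mem_range.mp hj)
    _ = C * ∑ j ∈ range k, θ ^ (k - j) := by rw [mul_sum]
    _ ≤ C * (θ / (1 - θ)) := by gcongr; exact sum_pow_sub_le hθ0 hθ1 k
    _ = C * θ / (1 - θ) := by ring

/-- **Drift transfer, composed ⇒ flow (the direction the endpoint argument consumes).**  If the composed marginal
coefficient drifts, `|c_k − b k| ≤ A`, and (II) holds, then the flow partial sums satisfy `Beta.Drift.OneLoopDrift b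
(A + Cθ/(1−θ)) β0` — the SAME slope `b`. [folklore] -/
theorem oneLoopDrift_of_composedDrift {C θ b A : ℝ} {μ : ℕ → ℕ → ℝ} {β0 : ℕ → ℝ} (hC : 0 ≤ C) (hθ0 : 0 ≤ θ)
    (hθ1 : θ < 1) (hsep : SeparationRate C θ μ β0) (hc : ∀ k : ℕ, |composedCoeff μ k - b * k| ≤ A) :
    Drift.OneLoopDrift b (A + C * θ / (1 - θ)) β0 := by
  intro k
  have hd := abs_defect_le_of_separationRate hC hθ0 hθ1 hsep k
  have hck := hc k
  have : ∑ j ∈ range k, β0 j - b * k = (composedCoeff μ k - b * k) - defect μ β0 k := by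
    unfold defect flowSum; ring
  rw [this]
  calc |composedCoeff μ k - b * k - defect μ β0 k| ≤ |composedCoeff μ k - b * k| + |defect μ β0 k| := abs_sub _ _
    _ ≤ A + C * θ / (1 - θ) := add_le_add hck hd

/-- **Drift transfer, flow ⇒ composed.**  Conversely `OneLoopDrift b A β0` and (II) give `|c_k − b k| ≤ A + Cθ/(1−θ)`
for the composed coefficient. [folklore] -/
theorem composedDrift_of_oneLoopDrift {C θ b A : ℝ} {μ : ℕ → ℕ → ℝ} {β0 : ℕ → ℝ} (hC : 0 ≤ C) (hθ0 : 0 ≤ θ)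
    (hθ1 : θ < 1) (hsep : SeparationRate C θ μ β0) (hd : Drift.OneLoopDrift b A β0) (k : ℕ) :
    |composedCoeff μ k - b * k| ≤ A + C * θ / (1 - θ) := by
  have hdef := abs_defect_le_of_separationRate hC hθ0 hθ1 hsep k
  have hk := hd k
  have : composedCoeff μ k - b * k = (∑ j ∈ range k, β0 j - b * k) + defect μ β0 k := by
    unfold defect flowSum; ring
  rw [this]
  calc |∑ j ∈ range k, β0 j - b * k + defect μ β0 k| ≤ |∑ j ∈ range k, β0 j - b * k| + |defect μ β0 k| :=
        abs_add_le _ _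
    _ ≤ A + C * θ / (1 - θ) := add_le_add hk hdef

/-! ## (III) the relative-rate shape (cell O-an2-5) and why it is too weak -/

/-- HYPOTHESIS SHAPE (III) (the cell's O-an2-5 typing): the contribution of old term `j` changes little from step `m`
to step `m+1`, at a rate geometric in `m − j`: `|μ j (m+1) − μ j m| ≤ C θ^{m−j}` for `j < m` (a predicate, never a fact). [folklore] -/
def RelativeRate (C θ : ℝ) (μ : ℕ → ℕ → ℝ) : Prop :=
  ∀ j m : ℕ, j < m → |μ j (m + 1) - μ j m| ≤ C * θ ^ (m - j)

/-- (II) implies (III) with constant `2C` (for `0 ≤ C`, `0 ≤ θ ≤ 1`). [folklore] -/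
theorem relativeRate_of_separationRate {C θ : ℝ} {μ : ℕ → ℕ → ℝ} {β0 : ℕ → ℝ} (hC : 0 ≤ C) (hθ0 : 0 ≤ θ)
    (hθ1 : θ ≤ 1) (h : SeparationRate C θ μ β0) : RelativeRate (2 * C) θ μ := by
  intro j m hjm
  have h1 := h j (m + 1) (by omega)
  have h2 := h j m hjm
  have hpow : θ ^ (m + 1 - j) ≤ θ ^ (m - j) := pow_le_pow_of_le_one hθ0 hθ1 (by omega)
  calc |μ j (m + 1) - μ j m| = |(μ j (m + 1) - β0 j) - (μ j m - β0 j)| := by ring_nf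
    _ ≤ |μ j (m + 1) - β0 j| + |μ j m - β0 j| := abs_sub _ _
    _ ≤ C * θ ^ (m + 1 - j) + C * θ ^ (m - j) := add_le_add h1 h2
    _ ≤ C * θ ^ (m - j) + C * θ ^ (m - j) := by gcongr
    _ = 2 * C * θ ^ (m - j) := by ring

/-- Telescoping under (III): `|μ j (j+1+n) − μ j (j+1)| ≤ C Σ_{i<n} θ^{i+1}`. [folklore] -/
theorem abs_sub_le_sum_of_relativeRate {C θ : ℝ} {μ : ℕ → ℕ → ℝ} (h : RelativeRate C θ μ) (j n : ℕ) :
    |μ j (j + 1 + n) - μ j (j + 1)| ≤ C * ∑ i ∈ range n, θ ^ (i + 1) := by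
  induction n with
  | zero => simp
  | succ n ih =>
    have hstep := h j (j + 1 + n) (by omega)
    rw [show j + 1 + n - j = n + 1 by omega] at hstep
    rw [sum_range_succ, mul_add]
    calc |μ j (j + 1 + (n + 1)) - μ j (j + 1)|
        = |(μ j (j + 1 + n + 1) - μ j (j + 1 + n)) + (μ j (j + 1 + n) - μ j (j + 1))| := by ring_nf
      _ ≤ |μ j (j + 1 + n + 1) - μ j (j + 1 + n)| + |μ j (j + 1 + n) - μ j (j + 1)| := abs_add_le _ _
      _ ≤ C * θ ^ (n + 1) + C * ∑ i ∈ range n, θ ^ (i + 1) := add_le_add hstep ih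
      _ = C * ∑ i ∈ range n, θ ^ (i + 1) + C * θ ^ (n + 1) := by ring

/-- **(III) gives a per-`j` bound only.**  Under `RelativeRate C θ` (`0 ≤ C`, `0 ≤ θ < 1`):
`|μ j k − μ j (j+1)| ≤ Cθ/(1−θ)` for `j < k`. [folklore] -/
theorem abs_sub_le_of_relativeRate {C θ : ℝ} {μ : ℕ → ℕ → ℝ} (hC : 0 ≤ C) (hθ0 : 0 ≤ θ) (hθ1 : θ < 1)
    (h : RelativeRate C θ μ) {j k : ℕ} (hjk : j < k) : |μ j k - μ j (j + 1)| ≤ C * θ / (1 - θ) := by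
  obtain ⟨n, hn⟩ := Nat.exists_eq_add_of_le (show j + 1 ≤ k by omega)
  subst hn
  have hgeom : ∑ i ∈ range n, θ ^ (i + 1) ≤ θ / (1 - θ) := by
    have hg := geom_sum_Ico_le_of_lt_one hθ0 hθ1 (m := 0) (n := n)
    rw [pow_zero, ← range_eq_Ico] at hg
    calc ∑ i ∈ range n, θ ^ (i + 1) = θ * ∑ i ∈ range n, θ ^ i := by
          rw [mul_sum]; exact sum_congr rfl fun i _ => by rw [pow_succ]; ring
      _ ≤ θ * (1 / (1 - θ)) := by gcongr
      _ = θ / (1 - θ) := by ring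
  calc |μ j (j + 1 + n) - μ j (j + 1)| ≤ C * ∑ i ∈ range n, θ ^ (i + 1) := abs_sub_le_sum_of_relativeRate h j n
    _ ≤ C * (θ / (1 - θ)) := by gcongr
    _ = C * θ / (1 - θ) := by ring

/-- **(III) ⇒ only a LINEAR defect bound.**  If the flow coefficient is the first-step contribution, `β0 j = μ j (j+1)`,
then (III) gives `|defect| ≤ k · Cθ/(1−θ)` — growing with the number of steps. [folklore] -/
theorem abs_defect_le_linear_of_relativeRate {C θ : ℝ} {μ : ℕ → ℕ → ℝ} {β0 : ℕ → ℝ} (hC : 0 ≤ C) (hθ0 : 0 ≤ θ)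
    (hθ1 : θ < 1) (h : RelativeRate C θ μ) (hβ : ∀ j, β0 j = μ j (j + 1)) (k : ℕ) :
    |defect μ β0 k| ≤ k * (C * θ / (1 - θ)) := by
  rw [defect_eq_sum]
  calc |∑ j ∈ range k, (μ j k - β0 j)| ≤ ∑ j ∈ range k, |μ j k - β0 j| := abs_sum_le_sum_abs _ _
    _ ≤ ∑ j ∈ range k, C * θ / (1 - θ) := sum_le_sum fun j hj => by
        rw [hβ j]; exact abs_sub_le_of_relativeRate hC hθ0 hθ1 h (mem_range.mp hj)
    _ = k * (C * θ / (1 - θ)) := by rw [sum_const, card_range, nsmul_eq_mul]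

/-! ## Witnesses: (III) does not control the composed coefficient -/

/-- WITNESS 1 (slope change): old term `j` contributes `b` at its own step and `b + δ` at every later step.
[folklore] -/
def slopeWitness (b δ : ℝ) : ℕ → ℕ → ℝ := fun j m => if m = j + 1 then b else b + δ

/-- `slopeWitness` satisfies (III) with `C = 2|δ|`, `θ = 1/2`. [folklore] -/
theorem slopeWitness_relativeRate (b δ : ℝ) : RelativeRate (2 * |δ|) (1 / 2) (slopeWitness b δ) := by
  intro j m hjm
  unfold slopeWitness
  by_cases hm : m = j + 1
  · subst hm
    rw [if_neg (by omega), if_pos rfl, show j + 1 - j = 1 by omega, show b + δ - b = δ by ring]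
    exact le_of_eq (by ring)
  · rw [if_neg (by omega), if_neg hm, sub_self, abs_zero]
    positivity

/-- Its first-step contributions are the constant flow coefficient `b`. [folklore] -/
theorem slopeWitness_first (b δ : ℝ) (j : ℕ) : slopeWitness b δ j (j + 1) = b := by
  simp [slopeWitness]

/-- Its composed coefficient after `k+1` steps is `b (k+1) + k δ`: the slope is `b + δ`, not `b`. [folklore] -/
theorem composedCoeff_slopeWitness (b δ : ℝ) (k : ℕ) :
    composedCoeff (slopeWitness b δ) (k + 1) = b * (k + 1) + k * δ := by
  unfold composedCoeff slopeWitness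
  rw [sum_range_succ, if_pos rfl]
  have : ∑ j ∈ range k, (if k + 1 = j + 1 then b else b + δ) = ∑ j ∈ range k, (b + δ) :=
    sum_congr rfl fun j hj => by rw [if_neg (by have := mem_range.mp hj; omega)]
  rw [this, sum_const, card_range, nsmul_eq_mul]
  ring

/-- Hence for `δ ≠ 0` the composed coefficient of `slopeWitness` does NOT drift with the flow's slope `b`
(although the flow partial sums `b k` trivially do, with `A = 0`). [folklore] -/
theorem slopeWitness_not_drift_same_slope (b : ℝ) {δ : ℝ} (hδ : δ ≠ 0) (A : ℝ) :
    ¬ ∀ k : ℕ, |composedCoeff (slopeWitness b δ) k - b * k| ≤ A := by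
  intro h
  obtain ⟨n, hn⟩ := exists_nat_gt (A / |δ|)
  have hk := h (n + 1)
  rw [composedCoeff_slopeWitness] at hk
  have hδ' : 0 < |δ| := abs_pos.mpr hδ
  have : |b * (↑n + 1) + ↑n * δ - b * ↑(n + 1)| = n * |δ| := by
    push_cast
    rw [show b * ((n : ℝ) + 1) + n * δ - b * (n + 1) = n * δ by ring, abs_mul, Nat.abs_cast]
  rw [this] at hk
  have := (div_lt_iff₀ hδ').mp hn
  linarith

/-- The sign pattern `(−1)^{⌊log₂(j+1)⌋}`: constant on the dyadic blocks `j+1 ∈ [2^i, 2^{i+1})`, alternating from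
block to block. [folklore] -/
def sgn2 (j : ℕ) : ℝ := (-1) ^ Nat.log 2 (j + 1)

/-- `|sgn2 j| = 1`. [folklore] -/
theorem abs_sgn2 (j : ℕ) : |sgn2 j| = 1 := by
  simp [sgn2]

/-- On the dyadic block `j ∈ [2^i − 1, 2^{i+1} − 1)` the sign is `(−1)^i`. [folklore] -/
theorem sgn2_eq_of_mem_block {i j : ℕ} (hj : j ∈ Ico (2 ^ i - 1) (2 ^ (i + 1) - 1)) : sgn2 j = (-1) ^ i := by
  rw [mem_Ico] at hj
  have hpos : 1 ≤ 2 ^ i := Nat.one_le_two_pow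
  have hlog : Nat.log 2 (j + 1) = i := Nat.log_eq_of_pow_le_of_lt_pow (by omega) (by omega)
  simp [sgn2, hlog]

/-- The block sum of the signs: `Σ_{j ∈ [2^i−1, 2^{i+1}−1)} sgn2 j = 2^i (−1)^i`. [folklore] -/
theorem sum_sgn2_block (i : ℕ) : ∑ j ∈ Ico (2 ^ i - 1) (2 ^ (i + 1) - 1), sgn2 j = 2 ^ i * (-1) ^ i := by
  rw [sum_congr rfl fun j hj => sgn2_eq_of_mem_block hj, sum_const, Nat.card_Ico, nsmul_eq_mul]
  have hpos : 1 ≤ 2 ^ i := Nat.one_le_two_pow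
  have : 2 ^ (i + 1) - 1 - (2 ^ i - 1) = 2 ^ i := by rw [pow_succ]; omega
  rw [this]
  push_cast
  ring

/-- WITNESS 2 (no drift at all): old term `j` contributes `b` at its own step and `b + δ·sgn2 j` at every later
step. [folklore] -/
def oscWitness (b δ : ℝ) : ℕ → ℕ → ℝ := fun j m => if m = j + 1 then b else b + δ * sgn2 j

/-- `oscWitness` satisfies (III) with `C = 2|δ|`, `θ = 1/2`. [folklore] -/
theorem oscWitness_relativeRate (b δ : ℝ) : RelativeRate (2 * |δ|) (1 / 2) (oscWitness b δ) := by
  intro j m hjm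
  unfold oscWitness
  by_cases hm : m = j + 1
  · subst hm
    rw [if_neg (by omega), if_pos rfl, show j + 1 - j = 1 by omega]
    rw [show b + δ * sgn2 j - b = δ * sgn2 j by ring, abs_mul, abs_sgn2]
    exact le_of_eq (by ring)
  · rw [if_neg (by omega), if_neg hm, sub_self, abs_zero]
    positivity

/-- Its first-step contributions are the constant flow coefficient `b` (so the flow partial sums are `b k`: a perfect
drift, and any limit/sign hypothesis on the flow coefficients holds trivially for `b > 0`). [folklore] -/
theorem oscWitness_first (b δ : ℝ) (j : ℕ) : oscWitness b δ j (j + 1) = b := by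
  simp [oscWitness]

/-- Its composed coefficient after `k+1` steps is `b (k+1) + δ Σ_{j<k} sgn2 j`. [folklore] -/
theorem composedCoeff_oscWitness (b δ : ℝ) (k : ℕ) :
    composedCoeff (oscWitness b δ) (k + 1) = b * (k + 1) + δ * ∑ j ∈ range k, sgn2 j := by
  unfold composedCoeff oscWitness
  rw [sum_range_succ, if_pos rfl]
  have : ∑ j ∈ range k, (if k + 1 = j + 1 then b else b + δ * sgn2 j) = ∑ j ∈ range k, (b + δ * sgn2 j) :=
    sum_congr rfl fun j hj => by rw [if_neg (by have := mem_range.mp hj; omega)]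
  rw [this, sum_add_distrib, sum_const, card_range, nsmul_eq_mul, ← mul_sum]
  ring

/-- **No drift line fits the composed coefficient of `oscWitness`** (`δ ≠ 0`): for every slope `b′` and every `A`,
`|c_k − b′ k| ≤ A` fails for some `k` — although (III) holds and the flow partial sums are exactly `b k`.  So the
relative-rate shape (III), even together with a perfect drift (or limit) of the flow coefficients, does not give the
drift form for the composed coefficient. [folklore] -/
theorem oscWitness_no_drift (b : ℝ) {δ : ℝ} (hδ : δ ≠ 0) (b' A : ℝ) :
    ¬ ∀ k : ℕ, |composedCoeff (oscWitness b δ) k - b' * k| ≤ A := by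
  intro h
  have hδ' : 0 < |δ| := abs_pos.mpr hδ
  -- the composed coefficient at `n+1` steps, for `n = 2^i − 1`, `2^{i+1} − 1`, `2^{i+2} − 1`
  set D : ℕ → ℝ := fun n => ∑ j ∈ range n, sgn2 j with hD
  have hc : ∀ n : ℕ, |(b - b') * (n + 1) + δ * D n| ≤ A := fun n => by
    have := h (n + 1)
    rw [composedCoeff_oscWitness] at this
    push_cast at this
    rw [show b * ((n : ℝ) + 1) + δ * ∑ j ∈ range n, sgn2 j - b' * (n + 1) = (b - b') * (n + 1) + δ * D n by
      rw [hD]; ring] at this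
    exact this
  have hblock : ∀ i : ℕ, D (2 ^ (i + 1) - 1) - D (2 ^ i - 1) = 2 ^ i * (-1) ^ i := fun i => by
    have hle : 2 ^ i - 1 ≤ 2 ^ (i + 1) - 1 := by
      have := Nat.pow_le_pow_right (show 0 < 2 by norm_num) (Nat.le_succ i); omega
    rw [hD]
    simp only
    rw [← sum_Ico_eq_sub _ hle, sum_sgn2_block]
  have hcast : ∀ i : ℕ, ((2 ^ (i + 1) - 1 : ℕ) : ℝ) - ((2 ^ i - 1 : ℕ) : ℝ) = 2 ^ i := fun i => by
    have h1 : 1 ≤ 2 ^ i := Nat.one_le_two_pow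
    have h2 : 1 ≤ 2 ^ (i + 1) := Nat.one_le_two_pow
    rw [Nat.cast_sub h1, Nat.cast_sub h2]
    push_cast
    ring
  -- two consecutive block differences pin `b − b'` against `+δ(−1)^i` and `−δ(−1)^i` simultaneously
  have hpair : ∀ i : ℕ, |((b - b') + δ * (-1) ^ i) * 2 ^ i| ≤ 2 * A := fun i => by
    have h1 := hc (2 ^ i - 1)
    have h2 := hc (2 ^ (i + 1) - 1)
    have key : ((b - b') + δ * (-1) ^ i) * 2 ^ i
        = ((b - b') * (((2 ^ (i + 1) - 1 : ℕ) : ℝ) + 1) + δ * D (2 ^ (i + 1) - 1))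
          - ((b - b') * (((2 ^ i - 1 : ℕ) : ℝ) + 1) + δ * D (2 ^ i - 1)) := by
      have := hblock i
      have := hcast i
      linear_combination (-(b - b')) * hcast i - δ * hblock i
    rw [key]
    calc _ ≤ |(b - b') * (((2 ^ (i + 1) - 1 : ℕ) : ℝ) + 1) + δ * D (2 ^ (i + 1) - 1)|
            + |(b - b') * (((2 ^ i - 1 : ℕ) : ℝ) + 1) + δ * D (2 ^ i - 1)| := abs_sub _ _
      _ ≤ A + A := add_le_add h2 h1
      _ = 2 * A := by ring
  obtain ⟨i, hi⟩ := pow_unbounded_of_one_lt (2 * A / |δ|) (one_lt_two (α := ℝ))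
  have hp : (0 : ℝ) < 2 ^ i := by positivity
  have e1 := hpair i
  have e2 := hpair (i + 1)
  rw [abs_mul, abs_of_pos hp] at e1
  rw [abs_mul, abs_of_pos (by positivity : (0 : ℝ) < 2 ^ (i + 1)), pow_succ, pow_succ] at e2
  -- |x + y| 2^i ≤ 2A and |x − y| 2^{i+1} ≤ 2A with |y| = |δ| force |δ| 2^i ≤ 2A
  have hy : |δ * (-1 : ℝ) ^ i| = |δ| := by rw [abs_mul, abs_pow, abs_neg, abs_one, one_pow, mul_one]
  have htri : 2 * |δ * (-1 : ℝ) ^ i| ≤ |(b - b') + δ * (-1) ^ i| + |(b - b') + δ * ((-1) ^ i * (-1))| := by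
    have : 2 * (δ * (-1 : ℝ) ^ i) = ((b - b') + δ * (-1) ^ i) - ((b - b') + δ * ((-1) ^ i * (-1))) := by ring
    rw [show 2 * |δ * (-1 : ℝ) ^ i| = |2 * (δ * (-1) ^ i)| by
      rw [abs_mul (2 : ℝ), abs_two], this]
    exact abs_sub _ _
  rw [hy] at htri
  have hA1 : |(b - b') + δ * (-1) ^ i| ≤ 2 * A / 2 ^ i := by
    rw [le_div_iff₀ hp]; exact e1
  have hA2 : |(b - b') + δ * ((-1) ^ i * (-1))| ≤ 2 * A / 2 ^ (i + 1) := by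
    rw [le_div_iff₀ (by positivity), pow_succ]; linarith [e2]
  have hA2' : 2 * A / 2 ^ (i + 1) ≤ 2 * A / 2 ^ i := by
    have hA0 : 0 ≤ A := le_trans (abs_nonneg _) (hc 0)
    apply div_le_div_of_nonneg_left (by linarith) hp
    rw [pow_succ]; linarith
  have : 2 * |δ| ≤ 4 * A / 2 ^ i := by
    calc 2 * |δ| ≤ 2 * A / 2 ^ i + 2 * A / 2 ^ i := by linarith
      _ = 4 * A / 2 ^ i := by ring
  -- contradiction with the choice of `i`: 2A/|δ| < 2^i
  have h3 : 2 * A < 2 ^ i * |δ| := by rwa [div_lt_iff₀ hδ'] at hi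
  have h4 : 2 * |δ| * 2 ^ i ≤ 4 * A := by rwa [le_div_iff₀ hp] at this
  nlinarith

end Literature.MathematicalPhysics.QuantumFieldTheory.Balaban1983to89.Beta.MarginalTelescoping
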